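import Mathlib
import HarnessLib
import Summits.Ventures.LatticeQCDFlow.Exactness.SphereFlowDecorrelationCone
import Summits.Ventures.LatticeQCDFlow.Exactness.SphereLOFlowLightCone

/-!
# The law of the exactly LO-flowed uniform configuration of the lattice CP(N−1)/O(N) action has no correlations beyond the light cone: `|Cov(A, B)| ≤ 2τ_m(ℓ_A b + a ℓ_B)`, `τ_m = 2e^{K|t|}(K|t|)^{m+1}/(m+1)!`, `K = 3|κ|υ/(d−1)`, in every volume

HONEST FRAMING: exact (Metropolis-corrected) sampling algorithms for lattice gauge theory;
figures of merit are autocorrelation/cost numbers at stated couplings and volumes; no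
continuum-physics claim.

Venture `LatticeQCDFlow` (cell pub-lqcd), topic `Exactness`; FANOUT row 7 (`s0-cpn-null`: the
S0-D1 rung — 2D CP⁹, Lüscher's LO trivializing map inside HMC, Engel–Schaefer 2011).  NEW WORK of
the cell over this leg's `Exactness/SphereFlowDecorrelationCone.lean` (decorrelation beyond the
cone for every sphere flow whose generator has strict read sets) and
`Exactness/SphereLOFlowLightCone.lean` (the sup-modulus `K = 3|κ|υ/(d−1)` of the E–S leading-order
generator on the read sets `{n} ∪ couplingNbhd U n`); nothing is cited as a fact.  Printed
counterpart, NAMED ONLY: M. Lüscher 2010 §4.5; Engel–Schaefer 2011 §3; the venture statement's T9.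


## Content

* **`abs_cov_comp_loFlow_le`** — for the E–S action (`d ≥ 2`, no self-coupling, adjoint pairs,
  local weight `≤ υ`, `υ ≥ 0`), read sets `N n = {n} ∪ couplingNbhd U n`, `K = 3|κ|υ/(d−1)`,
  continuous observables `A`, `B` bounded by `a`, `b` on `Ω̃` with footprints `S_A`, `S_B`,
  sup-Lipschitz moduli `ℓ_A`, `ℓ_B`, and disjoint radius-`m` read-set neighbourhoods:
  `|Cov_π̄(A∘Φ_{t₀→t₁}, B∘Φ_{t₀→t₁})| ≤ 2·(2e^{K|t₁−t₀|}(K|t₁−t₀|)^{m+1}/(m+1)!)·(ℓ_A b + a ℓ_B)` —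
  the exact LO map cannot create correlations beyond its cone, whatever the correlation length of
  the target `e^{−cS}π̄/Z_c` (the locality barrier, quantified for this map).

NOT CLAIMED: lower bounds on the target's correlations; the one-step map of the rung; numbers.
-/

noncomputable section

namespace Summit.Ventures.LatticeQCDFlow.Exactness

open Function Set Metric MeasureTheory NormedSpace InnerProductSpace
open scoped RealInnerProductSpace Topology Nat

variable {Λ : Type*} {E : Type*} [NormedAddCommGroup E] [InnerProductSpace ℝ E]
  [FiniteDimensional ℝ E] [Fintype Λ] [DecidableEq Λ] {G : ℝ → (Λ → E) → ℝ} {T : ℝ}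

/-! ## §3 The exact leading-order flow of the E–S action -/

section LO

variable [MeasurableSpace E] [BorelSpace E] [Nontrivial E] {U : Λ → Λ → (E →L[ℝ] E)}

/-- **THE LAW OF THE EXACTLY LO-FLOWED UNIFORM CONFIGURATION HAS NO CORRELATIONS BEYOND THE LIGHT
CONE, UNIFORMLY IN THE VOLUME.**  For the E–S action (`d ≥ 2`, no self-coupling, adjoint pairs,
local weight `≤ υ`, `υ ≥ 0`), read sets `N n = {n} ∪ couplingNbhd U n`, `K = 3|κ|υ/(d−1)`,
continuous observables `A`, `B` bounded by `a`, `b` on `Ω̃` with footprints `S_A`, `S_B` and sup-Lipschitz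
moduli `ℓ_A`, `ℓ_B`, and a radius `m` with `⋃_{S_A} nball N m` and `⋃_{S_B} nball N m` disjoint:
`|Cov_π̄(A∘Φ_{t₀→t₁}, B∘Φ_{t₀→t₁})| ≤ 2·(2e^{K|t₁−t₀|}(K|t₁−t₀|)^{m+1}/(m+1)!)·(ℓ_A b + a ℓ_B)`. -/
theorem abs_cov_comp_loFlow_le (hU0 : ∀ n, U n n = 0)
    (hUadj : ∀ m n (v w : E), ⟪U m n v, w⟫ = ⟪v, U n m w⟫) (hd : 2 ≤ Module.finrank ℝ E)
    (κ S₀ : ℝ) {υ : ℝ} (hυ : ∀ k, ∑ m, ‖U k m‖ ≤ υ) (hυ0 : 0 ≤ υ) (t₀ t₁ : ℝ) (m : ℕ)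
    {A B : (Λ → E) → ℝ} (hAc : Continuous A) (hBc : Continuous B) {SA SB : Set Λ}
    {a b ℓA ℓB : ℝ} (hAa : ∀ x : Λ → E, (∀ n, ‖x n‖ = 1) → |A x| ≤ a)
    (hBb : ∀ x : Λ → E, (∀ n, ‖x n‖ = 1) → |B x| ≤ b)
    (hAℓ : ∀ x y : Λ → E, (∀ n, ‖x n‖ = 1) → (∀ n, ‖y n‖ = 1) → ∀ η : ℝ,
      (∀ i ∈ SA, ‖x i - y i‖ ≤ η) → |A x - A y| ≤ ℓA * η)
    (hBℓ : ∀ x y : Λ → E, (∀ n, ‖x n‖ = 1) → (∀ n, ‖y n‖ = 1) → ∀ η : ℝ,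
      (∀ i ∈ SB, ‖x i - y i‖ ≤ η) → |B x - B y| ≤ ℓB * η)
    (hsep : Disjoint (⋃ i ∈ SA, nball (fun n => insert n (couplingNbhd U n)) m i)
      (⋃ j ∈ SB, nball (fun n => insert n (couplingNbhd U n)) m j)) :
    |∫ ω, A (sphereTDFlow (G := fun _ : ℝ => loFlowAction κ S₀ U)
            (contDiff_const_family (contDiff_loFlowAction U κ S₀)) T t₀ t₁
            (fun n => ((ω : Λ → sphere (0 : E) 1) n : E))) *
          B (sphereTDFlow (G := fun _ : ℝ => loFlowAction κ S₀ U)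
            (contDiff_const_family (contDiff_loFlowAction U κ S₀)) T t₀ t₁ (fun n => (ω n : E)))
          ∂Measure.pi (fun _ : Λ => uniformSphere (volume : Measure E)) -
        (∫ ω, A (sphereTDFlow (G := fun _ : ℝ => loFlowAction κ S₀ U)
            (contDiff_const_family (contDiff_loFlowAction U κ S₀)) T t₀ t₁
            (fun n => ((ω : Λ → sphere (0 : E) 1) n : E)))
            ∂Measure.pi (fun _ : Λ => uniformSphere (volume : Measure E))) *
          ∫ ω, B (sphereTDFlow (G := fun _ : ℝ => loFlowAction κ S₀ U)
            (contDiff_const_family (contDiff_loFlowAction U κ S₀)) T t₀ t₁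
            (fun n => ((ω : Λ → sphere (0 : E) 1) n : E)))
            ∂Measure.pi (fun _ : Λ => uniformSphere (volume : Measure E))| ≤
      2 * (2 * Real.exp (3 * |κ| * υ / ((Module.finrank ℝ E : ℝ) - 1) * |t₁ - t₀|) *
          (3 * |κ| * υ / ((Module.finrank ℝ E : ℝ) - 1) * |t₁ - t₀|) ^ (m + 1) / ((m + 1)! : ℝ)) *
        (ℓA * b + a * ℓB) := by
  have hd1 : 0 < (Module.finrank ℝ E : ℝ) - 1 := by
    have : (2 : ℝ) ≤ Module.finrank ℝ E := by exact_mod_cast hd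
    linarith
  have hK : 0 ≤ 3 * |κ| * υ / ((Module.finrank ℝ E : ℝ) - 1) := div_nonneg (by positivity) hd1.le
  exact abs_cov_comp_sphereTDFlow_le (G := fun _ : ℝ => loFlowAction κ S₀ U)
    (contDiff_const_family (contDiff_loFlowAction U κ S₀)) (fun n => insert n (couplingNbhd U n)) hK
    (fun _ _ x' y' hx' hy' i M hM hN =>
      norm_siteGrad_loFlowAction_sub_le_of_readSet hU0 hUadj hd κ S₀ hυ hx' hy' i hM hN)
    m hAc hBc hAa hBb hAℓ hBℓ hsep

end LO

end Summit.Ventures.LatticeQCDFlow.Exactness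

end
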